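import Summits.CriticalPhenomena.PercolationContinuityZ3.Theorems.PercNearOneGluingNoHeavyQuantGappedForestLaws
import Summits.CriticalPhenomena.PercolationContinuityZ3.Theorems.PercNearOneGluingNoHeavyQuantDECOneLow
import Summits.CriticalPhenomena.PercolationContinuityZ3.Theorems.PercNearOneGluingNoHeavyQuantResidDEC
import HarnessLib

/-!
# QUANT lane R8, T-DEC: CENSUS-2's REGRESSION WITNESS FAMILY `(R¹[q](R²[s]))³` IS SDEC AT ITS FLOOR ON THE WHOLE LIGHT REGION `qs ≤ 1/2`
# — the first RESID-DEC certificate with a PAIRED low atom in the kernel: `ResidDECAt x a L` for every outer gate by the one-low peeling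
# lemma with the single pair `{2, 5; γ}` (census-1 gen 24)

builds on p205010 (kernel theorem, internal audit signed; external expert review pending)

Support file (`--supports stmt-CriticalPhenomena-4575`), QUANT lane seat prim-quant-census-1 (gen 24); memo
`run/shared/lean/prim/quant/prim-quant-census-1/RESID-DEC-G24.md` §3–§4.  Theorems only (no definitions, no `@[conjecture]`), standard axioms, no
sorries.  Uses arm-1 g49's `gluedSib` binder and heavy-roots regime (`…QuantGluedForestSDEC`, `…QuantRootScaledHeavyRoots`: `decAt_resid_of_noLow`,
`resid_eq_zero_below`), this seat's one-low peeling lemma (`…QuantDECOneLow`: `decAt_all_of_oneLow`) and typer g41's node-of-record vocabulary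
(`…QuantResidDEC`: `ResidDECAt`, `sdec_flaw_of_residDECAt`; README V431).

THE FAMILY.  `t = R¹[q](R²[s])`: a root of gate `q` with ONE relay, one child of gate `s` with TWO relays (census-2 g73's regression witness at
`q = 19/20`, `s = 1/2`; README V422–V431: level-1 hull-irreducible, outside every certified regime so far — arm-1 g49's `sdec_gluedForest` needs
`3q(1+2s) ≤ 4`).  Forest `L = [t, t, t]`, floor `x < qs`, `fmean = 3q(1+2s)`, top `9`; forest law atoms `{0,1,2,3,4,5,6,7,9}` (`witnessF2_apply`,
`witnessF3_apply_*`: the explicit trinomial × binomial expansion).  THE RESIDUAL (`resid_witness`, closed form, `D = 2 − q − aq`):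
`R_a(0) = (2−q)(1−aq)²/D`, `R_a(1) = 0` (`resid_eq_zero_below`), `R_a(2) = 3aq(1−q)(1−aq)(1−s)²/D` (two roots open), `R_a(5) =
3aq²s(1−s)²((1−aq)+a(1−q))/D` (all roots open, one child open); every other charged atom is `≥ 3`.
THE CERTIFICATE at outer gate `a` (target `T = 3aq(1+2s) ≤ 6` on the light region): if `T ≤ 4` every positive atom is self-sufficient
(`decAt_resid_of_noLow`, R = 1); if `T > 4` the ONLY positive low atom is `2`, peeled onto the partner `5` at the gate `γ = max(a·x, (T−4)/3)`:
CAPACITY `R_a(2)·γ ≤ R_a(5)·(1−γ)` ⟺ `(1−q)(1−aq)γ ≤ qs((1−aq)+a(1−q))(1−γ)` — floor case (`witness_cap_floor`: `2a(1−q)(1−aq) ≤ (1−aq)+a(1−q)`,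
`aqs ≤ 1/2`) and lever case (`witness_cap_lever`: `(1−q)(3q+6qs−4) ≤ qs`, i.e. `−3(q−2/3)² − 1/6 + (5−6q)(qs−1/2) ≤ 0`); TORQUE SAFETY
`3·a·x ≤ T − 2` from `T > 4`, `aqs ≤ 1/2`; then `decAt_all_of_oneLow`.  Hence **`residDECAt_witness`**: `ResidDECAt x a L` for EVERY `0 < a < 1`, and
(`sdec_flaw_of_residDECAt`, sub-forest laws SDEC by `sdec_blobLaw`) **`sdec_witnessTriple`**: `SDEC (qs) 9 (flaw L)` for every `0 < q < 1`,
`0 < s < 1`, `qs ≤ 1/2` — in particular `sdec_witnessTriple_95_50`.  The census (memo §2) says the same two-tier certificate shape (atom `0` by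
levers, each positive low atom by one floor-gate / credit pair) covers every tested forest; this file is the first kernel instance with a pair.

* laws: `witnessG_apply`, `witnessF2_apply`/`witnessF2_eq`, `witnessF3_apply_zero/two/five`, `witnessG_eq_zero`, `flaw_witness` (`wco_three` from `…QuantGappedForestLaws`),
  **`resid_witness`**; inequalities: `witness_cap_floor`, `witness_cap_poly`, `witness_cap_lever`;
* **`residDECAt_witness`**, **`sdec_witnessTriple_lt`**, **`sdec_witnessTriple`**, `sdec_witnessTriple_95_50`.

HONEST STATUS: an explicit SDEC family (the list form of `SiblingStep` / the node `ResidDEC` holds on it, oracle discharged); `ResidDEC`,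
`SiblingStep`, `GateStepN`, `FarTreeRow` OPEN; RATE class log\* / honest sentence of `run/shared/lean/prim/quant/README.md` unchanged.  [this work];
binder and heavy-roots regime: prim-quant-arm-1 g48/g49; node of record: prim-quant-lead g47 (V431) / prim-quant-stmt g41; regression witness:
prim-quant-census-2 g73.  Nothing here is cited as a published result.  The gluing rows served [cite: KozmaNitzan2024, Conjecture 3 (p. 15)];
product measure [cite: Grimmett1999, §1.3 p. 10].
-/

noncomputable section

open scoped BigOperators

namespace Summit.CriticalPhenomena.PercolationContinuityZ3.Theorems
namespace Quant
namespace LawDec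

open Finset

local notation3 "δ[" K "]" => (fun k : ℕ => if k = (K : ℕ) then (1 : ℝ) else 0)

/-! ### The witness sibling `R¹[q](R²[s])` and its forest law on small atoms -/

/-- the gated witness sibling `gate (δ₁ ∗ gate δ₂ s) q` pointwise: atoms `0` (`1−q`), `1` (`q(1−s)`), `3` (`qs`). [this work] -/
theorem witnessG_apply (q s : ℝ) (h : ℕ) :
    gate (slice δ[1] 2 s) q h = (if h = 0 then 1 - q else 0) + (if h = 1 then q * (1 - s) else 0) + (if h = 3 then q * s else 0) := by
  rw [gate_apply, gluedSib_rho_apply 1 2 le_rfl (by norm_num) s h]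
  by_cases h0 : h = 0
  · subst h0; simp
  · by_cases h1 : h = 1
    · subst h1; simp
    · by_cases h3 : h = 3
      · subst h3; simp
      · rw [if_neg h1, if_neg (by omega), if_neg h0, if_neg h0, if_neg h1, if_neg h3]; ring

/-- the pair law `(gate ρ q)^{∗2}` pointwise (atoms `0,1,2,3,4,6`). [this work] -/
theorem witnessF2_apply (q s : ℝ) (h : ℕ) :
    lconv 3 3 (gate (slice δ[1] 2 s) q) (gate (slice δ[1] 2 s) q) h =
      (if h = 0 then (1 - q) ^ 2 else 0) + (if h = 1 then 2 * (1 - q) * (q * (1 - s)) else 0) +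
      (if h = 2 then (q * (1 - s)) ^ 2 else 0) + (if h = 3 then 2 * (1 - q) * (q * s) else 0) +
      (if h = 4 then 2 * (q * (1 - s)) * (q * s) else 0) + (if h = 6 then (q * s) ^ 2 else 0) := by
  simp only [lconv, Finset.sum_range_succ, Finset.sum_range_zero, witnessG_apply]
  by_cases h0 : h = 0
  · subst h0; norm_num; ring
  by_cases h1 : h = 1
  · subst h1; norm_num; ring
  by_cases h2 : h = 2
  · subst h2; norm_num; ring
  by_cases h3 : h = 3
  · subst h3; norm_num; ring
  by_cases h4 : h = 4
  · subst h4; norm_num; ring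
  by_cases h5 : h = 5
  · subst h5; norm_num
  by_cases h6 : h = 6
  · subst h6; norm_num; ring
  rw [if_neg h0, if_neg h1, if_neg h2, if_neg h3, if_neg h4, if_neg h6]
  simp [show (0:ℕ) ≠ h from Ne.symm h0, show (1:ℕ) ≠ h from Ne.symm h1, show (2:ℕ) ≠ h from Ne.symm h2,
    show (3:ℕ) ≠ h from Ne.symm h3, show (4:ℕ) ≠ h from Ne.symm h4, show (6:ℕ) ≠ h from Ne.symm h6]

/-- the pair law as a function. [this work] -/
theorem witnessF2_eq (q s : ℝ) :
    lconv 3 3 (gate (slice δ[1] 2 s) q) (gate (slice δ[1] 2 s) q) = fun h =>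
      (if h = 0 then (1 - q) ^ 2 else 0) + (if h = 1 then 2 * (1 - q) * (q * (1 - s)) else 0) +
      (if h = 2 then (q * (1 - s)) ^ 2 else 0) + (if h = 3 then 2 * (1 - q) * (q * s) else 0) +
      (if h = 4 then 2 * (q * (1 - s)) * (q * s) else 0) + (if h = 6 then (q * s) ^ 2 else 0) :=
  funext (witnessF2_apply q s)

/-- the triple law `(gate ρ q)^{∗3}` at the atom `0`: `(1−q)³`. [this work] -/
theorem witnessF3_apply_zero (q s : ℝ) :
    lconv 6 3 (lconv 3 3 (gate (slice δ[1] 2 s) q) (gate (slice δ[1] 2 s) q)) (gate (slice δ[1] 2 s) q) 0 = (1 - q) ^ 3 := by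
  rw [witnessF2_eq]
  simp only [lconv, Finset.sum_range_succ, Finset.sum_range_zero, witnessG_apply]
  norm_num; ring

/-- the triple law at the atom `2 = 2A` (two roots open, children closed): `3(1−q)q²(1−s)²`. [this work] -/
theorem witnessF3_apply_two (q s : ℝ) :
    lconv 6 3 (lconv 3 3 (gate (slice δ[1] 2 s) q) (gate (slice δ[1] 2 s) q)) (gate (slice δ[1] 2 s) q) 2 =
      3 * (1 - q) * q ^ 2 * (1 - s) ^ 2 := by
  rw [witnessF2_eq]
  simp only [lconv, Finset.sum_range_succ, Finset.sum_range_zero, witnessG_apply]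
  norm_num; ring

/-- the triple law at the atom `5 = 3A + B` (all roots open, one child open): `3q³s(1−s)²`. [this work] -/
theorem witnessF3_apply_five (q s : ℝ) :
    lconv 6 3 (lconv 3 3 (gate (slice δ[1] 2 s) q) (gate (slice δ[1] 2 s) q)) (gate (slice δ[1] 2 s) q) 5 =
      3 * q ^ 3 * s * (1 - s) ^ 2 := by
  rw [witnessF2_eq]
  simp only [lconv, Finset.sum_range_succ, Finset.sum_range_zero, witnessG_apply]
  norm_num; ring

/-- the gated witness sibling vanishes above `3`. [this work] -/
theorem witnessG_eq_zero (q s : ℝ) (h : ℕ) (hh : 3 < h) : gate (slice δ[1] 2 s) q h = 0 := by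
  rw [witnessG_apply, if_neg (by omega), if_neg (by omega), if_neg (by omega)]; ring

/-- **the forest law of the witness triple is the explicit triple convolution** (any recorded floor). [this work] -/
theorem flaw_witness (q s x₁ : ℝ) :
    flaw [gluedSib 1 2 q s x₁, gluedSib 1 2 q s x₁, gluedSib 1 2 q s x₁] =
      lconv 6 3 (lconv 3 3 (gate (slice δ[1] 2 s) q) (gate (slice δ[1] 2 s) q)) (gate (slice δ[1] 2 s) q) := by
  have hM : (gluedSib 1 2 q s x₁).M = 3 := rfl
  have hρ : (gluedSib 1 2 q s x₁).ρ = slice δ[1] 2 s := rfl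
  have hq : (gluedSib 1 2 q s x₁).q = q := rfl
  have e1 : lconv 0 3 (fun h => if h = 0 then (1 : ℝ) else 0) (gate (slice δ[1] 2 s) q) = gate (slice δ[1] 2 s) q :=
    funext fun k => lconv_delta_left 0 3 _ (witnessG_eq_zero q s) k
  simp only [flaw, ftop, hM, hρ, hq]
  rw [e1]

/-! ### The residual of the witness triple on the atoms `0`, `2`, `5` -/

/-- **THE RESIDUAL OF THE WITNESS TRIPLE IN CLOSED FORM ON THE ATOMS `0`, `2 = 2A`, `5 = 3A+B`** (`0 < a < 1`, `0 < q < 1`, `0 < s < 1`;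
`D := 2 − q − aq > 0`): `R_a(0) = (2−q)(1−aq)²/D`, `R_a(2) = 3aq(1−q)(1−aq)(1−s)²/D`, `R_a(5) = 3aq²s(1−s)²((1−aq) + a(1−q))/D`. [this work] -/
theorem resid_witness (q s x₁ a : ℝ) (hq0 : 0 < q) (hq1 : q < 1) (ha1 : a < 1) :
    resid a (wco a [gluedSib 1 2 q s x₁, gluedSib 1 2 q s x₁, gluedSib 1 2 q s x₁])
        [gluedSib 1 2 q s x₁, gluedSib 1 2 q s x₁, gluedSib 1 2 q s x₁] 0 = (2 - q) * (1 - a * q) ^ 2 / (2 - q - a * q) ∧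
    resid a (wco a [gluedSib 1 2 q s x₁, gluedSib 1 2 q s x₁, gluedSib 1 2 q s x₁])
        [gluedSib 1 2 q s x₁, gluedSib 1 2 q s x₁, gluedSib 1 2 q s x₁] 2 =
      3 * a * q * (1 - q) * (1 - a * q) * (1 - s) ^ 2 / (2 - q - a * q) ∧
    resid a (wco a [gluedSib 1 2 q s x₁, gluedSib 1 2 q s x₁, gluedSib 1 2 q s x₁])
        [gluedSib 1 2 q s x₁, gluedSib 1 2 q s x₁, gluedSib 1 2 q s x₁] 5 =
      3 * a * q ^ 2 * s * (1 - s) ^ 2 * ((1 - a * q) + a * (1 - q)) / (2 - q - a * q) := by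
  set L := [gluedSib 1 2 q s x₁, gluedSib 1 2 q s x₁, gluedSib 1 2 q s x₁] with hL
  have haq1 : a * q < 1 := by nlinarith
  have hne : (1 - a * q) ≠ 0 := by nlinarith
  have h1a : (1 - a) ≠ 0 := by linarith
  have hq0' : q ≠ 0 := hq0.ne'
  have hD : (2 - q - a * q) ≠ 0 := by nlinarith
  have hw : wco a L = ((1 - q) / (1 - a * q)) * ((1 - q) / (1 - a * q)) := wco_three a _
  have hF := flaw_witness q s x₁
  have hFa := flaw_witness (a * q) s x₁
  have hmap : L.map (Sib.scale a) = [gluedSib 1 2 (a * q) s x₁, gluedSib 1 2 (a * q) s x₁, gluedSib 1 2 (a * q) s x₁] := rfl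
  have e : ∀ h, resid a (wco a L) L h = (gate (flaw L) a h - wco a L * flaw (L.map (Sib.scale a)) h) / (1 - wco a L) := fun h => rfl
  have h1w : 1 - (1 - q) / (1 - a * q) * ((1 - q) / (1 - a * q)) = q * (1 - a) * (2 - q - a * q) / ((1 - a * q) * (1 - a * q)) := by
    rw [div_mul_div_comm, one_sub_div (mul_ne_zero hne hne)]
    congr 1
    ring
  refine ⟨?_, ?_, ?_⟩
  · rw [e, gate_apply, if_pos rfl, hmap, hL, hF, hFa, witnessF3_apply_zero, witnessF3_apply_zero, hw, h1w]
    field_simp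
    ring
  · rw [e, gate_apply, if_neg (by norm_num), hmap, hL, hF, hFa, witnessF3_apply_two, witnessF3_apply_two, hw, h1w]
    field_simp
    ring
  · rw [e, gate_apply, if_neg (by norm_num), hmap, hL, hF, hFa, witnessF3_apply_five, witnessF3_apply_five, hw, h1w]
    field_simp
    ring

/-! ### The capacity inequalities of the certificate -/
/-- **floor case of the capacity inequality** (`γ = a·x ≤ aqs`): `(1−q)(1−aq)γ ≤ qs((1−aq)+a(1−q))(1−γ)`. [this work] -/
theorem witness_cap_floor (a q s y : ℝ) (ha0 : 0 < a) (ha1 : a < 1) (hq0 : 0 < q) (hq1 : q < 1) (hs0 : 0 < s)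
    (hqs : q * s ≤ 1 / 2) (hy : y ≤ a * (q * s)) :
    (1 - q) * (1 - a * q) * y ≤ q * s * ((1 - a * q) + a * (1 - q)) * (1 - y) := by
  have hE : 2 * (a * (1 - q) * (1 - a * q)) ≤ (1 - a * q) + a * (1 - q) := by
    nlinarith [mul_nonneg (mul_nonneg ha0.le (sub_nonneg.2 hq1.le)) (mul_nonneg ha0.le hq0.le),
      mul_nonneg (sub_nonneg.2 (show a * q ≤ 1 by nlinarith)) (sub_nonneg.2 (show a * (1 - q) ≤ 1 by nlinarith))]
  have haqs : a * (q * s) ≤ 1 / 2 := by nlinarith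
  have hE0 : 0 ≤ (1 - a * q) + a * (1 - q) := by nlinarith
  -- y·((1−q)(1−aq) + qsE) ≤ aqs·(...) ≤ qsE
  have h1 : 0 ≤ (1 - q) * (1 - a * q) + q * s * ((1 - a * q) + a * (1 - q)) := by
    have : 0 ≤ (1 - q) * (1 - a * q) := mul_nonneg (by linarith) (by nlinarith)
    nlinarith [mul_nonneg (mul_nonneg hq0.le hs0.le) hE0]
  have h2 : y * ((1 - q) * (1 - a * q) + q * s * ((1 - a * q) + a * (1 - q)))
      ≤ a * (q * s) * ((1 - q) * (1 - a * q) + q * s * ((1 - a * q) + a * (1 - q))) :=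
    mul_le_mul_of_nonneg_right hy h1
  have h3 : a * ((1 - q) * (1 - a * q)) ≤ ((1 - a * q) + a * (1 - q)) * (1 - a * (q * s)) := by
    nlinarith
  nlinarith [mul_le_mul_of_nonneg_left h3 (mul_nonneg hq0.le hs0.le)]

/-- the polynomial core of the lever case: `(1−q)(3q+6u−4) ≤ u` for `0 ≤ u ≤ 1/2`. [this work] -/
theorem witness_cap_poly (q u : ℝ) (hq0 : 0 < q) (hq1 : q < 1) (hu0 : 0 ≤ u) (hu : u ≤ 1 / 2) :
    (1 - q) * (3 * q + 6 * u - 4) ≤ u := by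
  by_cases hq : q ≤ 5 / 6
  · nlinarith [sq_nonneg (q - 2 / 3), mul_nonneg (sub_nonneg.2 hq) (sub_nonneg.2 hu)]
  · have hq' : 5 / 6 < q := not_le.1 hq
    nlinarith [mul_nonneg hu0 (show (0:ℝ) ≤ 6 * q - 5 by linarith), mul_nonneg (sub_nonneg.2 hq1.le) (show (0:ℝ) ≤ 4 - 3 * q by linarith)]

/-- **lever case of the capacity inequality** (`γ = (T−4)/3`, `T = 3aq(1+2s) ∈ (4, 6]`). [this work] -/
theorem witness_cap_lever (a q s : ℝ) (ha0 : 0 < a) (ha1 : a < 1) (hq0 : 0 < q) (hq1 : q < 1) (hs0 : 0 < s)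
    (hqs : q * s ≤ 1 / 2) (hT : 4 < 3 * (a * q) * (1 + 2 * s)) :
    (1 - q) * (1 - a * q) * ((3 * (a * q) * (1 + 2 * s) - 4) / 3)
      ≤ q * s * ((1 - a * q) + a * (1 - q)) * (1 - (3 * (a * q) * (1 + 2 * s) - 4) / 3) := by
  have hpoly := witness_cap_poly q (q * s) hq0 hq1 (mul_nonneg hq0.le hs0.le) hqs
  have haq1 : a * q < 1 := by nlinarith
  have hT6 : 3 * (a * q) * (1 + 2 * s) ≤ 6 := by nlinarith
  -- (1−q)(T−4) ≤ (1−q)(3q+6qs−4) ≤ qs ≤ qs(7−T)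
  have h1 : (1 - q) * (3 * (a * q) * (1 + 2 * s) - 4) ≤ (1 - q) * (3 * q + 6 * (q * s) - 4) := by
    apply mul_le_mul_of_nonneg_left _ (by linarith)
    nlinarith [mul_nonneg hq0.le hs0.le]
  have h2 : q * s ≤ q * s * (7 - 3 * (a * q) * (1 + 2 * s)) := by
    have : 1 ≤ 7 - 3 * (a * q) * (1 + 2 * s) := by linarith
    nlinarith [mul_nonneg hq0.le hs0.le]
  have h3 : (1 - q) * (3 * (a * q) * (1 + 2 * s) - 4) ≤ q * s * (7 - 3 * (a * q) * (1 + 2 * s)) := by linarith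
  -- multiply by (1 − aq) ≤ E and divide by 3
  have hE : (1 - a * q) ≤ (1 - a * q) + a * (1 - q) := by nlinarith
  have h4 : q * s * (7 - 3 * (a * q) * (1 + 2 * s)) * (1 - a * q)
      ≤ q * s * (7 - 3 * (a * q) * (1 + 2 * s)) * ((1 - a * q) + a * (1 - q)) := by
    apply mul_le_mul_of_nonneg_left hE
    have : 0 ≤ 7 - 3 * (a * q) * (1 + 2 * s) := by linarith
    exact mul_nonneg (mul_nonneg hq0.le hs0.le) this
  have h5 := mul_le_mul_of_nonneg_right h3 (show 0 ≤ 1 - a * q by linarith)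
  nlinarith

/-! ### The witness triple: RESID-DEC at every outer gate, SDEC at every light floor -/

/-- **RESID-DEC AT EVERY OUTER GATE FOR THE WITNESS TRIPLE** `(R¹[q](R²[s]))³` at a light floor (`qs ≤ 1/2`): recorded sub-forest floor `s·y`,
`0 < y < 1`, floor `0 < x ≤ q·(s·y)`, `0 < a < 1` ⟹ `ResidDECAt x a L` (typer g41's certificate target of the node of record, README V431).
Below `a·fmean ≤ 4` this is arm-1 g49's heavy-roots regime (`decAt_resid_of_noLow`, `R = 1`); above it the residual's low atoms are `{0, 2}` and
the ONE-LOW PEELING LEMMA applies with the partner `5 = 3A + B`. [this work] -/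
theorem residDECAt_witness {q s x y a : ℝ} (hq0 : 0 < q) (hq1 : q < 1) (hs0 : 0 < s) (hs1 : s < 1) (hqs : q * s ≤ 1 / 2)
    (hx0 : 0 < x) (hy0 : 0 < y) (hy1 : y < 1) (hxy : x ≤ q * (s * y)) (ha0 : 0 < a) (ha1 : a < 1) :
    ResidDECAt x a [gluedSib 1 2 q s (s * y), gluedSib 1 2 q s (s * y), gluedSib 1 2 q s (s * y)] := by
  set g : Sib := gluedSib 1 2 q s (s * y) with hg
  set L : List Sib := [g, g, g] with hLdef
  have hqs0 : 0 < q * s := mul_pos hq0 hs0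
  have hx : x < q * s := by nlinarith [mul_lt_mul_of_pos_left hy1 hqs0]
  have hx1 : x < 1 := by linarith
  have hT : g.TreeOK x := gluedSib_treeOK 1 2 le_rfl (by norm_num) hq0 hq1 hs0 hs1 hy0 hy1 hxy
  have hmem : ∀ t ∈ L, t = g := fun t ht => by
    simp only [hLdef, List.mem_cons, List.mem_nil_iff, or_false] at ht
    rcases ht with h | h | h <;> exact h
  have hL : ∀ t ∈ L, t.TreeOK x := fun t ht => by rw [hmem t ht]; exact hT
  have hL' : ∀ t ∈ L, t.LawOK := fun t ht => (hL t ht).lawOK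
  have hq : ∀ t ∈ L, t.q = q := fun t ht => by rw [hmem t ht, hg]; rfl
  have hR : ∀ t ∈ L, ∀ h, h < 1 → t.ρ h = 0 := fun t ht h hh => by
    rw [hmem t ht]
    exact gluedSib_rho_below 1 2 le_rfl (by norm_num) s h hh
  have htop : ftop L = 9 := by simp only [hLdef, ftop, hg]; rfl
  have hfmean : fmean L = 3 * (q * (1 + 2 * s)) := by
    have e : fmean L = fmean (List.replicate 3 g) := by rw [hLdef]; rfl
    rw [e, fmean_replicate, hg, gluedSib_mean, show (gluedSib 1 2 q s (s * y)).q = q from rfl]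
    push_cast
    ring
  have hw1 : wco a L < 1 := wco_lt_one ha1 g g [g] hL'
  intro j hj
  by_cases hreg : a * fmean L ≤ 4
  · -- heavy-roots regime (arm-1 g49): the residual charges no atom below `2`, and `a·fmean ≤ 4 = 4·1`
    exact decAt_resid_of_noLow hx0 hx1 ha0 ha1.le 1 q L hL hq hR hw1 (by simpa using hreg) j hj
  · -- one positive low atom `2`: peel it onto `5`
    have hT4 : 4 < a * fmean L := lt_of_not_ge hreg
    have hT4' : 4 < 3 * (a * q) * (1 + 2 * s) := by rw [hfmean] at hT4; linarith
    have hax0 : 0 < a * x := mul_pos ha0 hx0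
    have hax1 : a * x < 1 := by nlinarith
    obtain ⟨r0, rM, r1, rmn⟩ := resid_laws ha0 ha1.le L hL' le_rfl hw1
    obtain ⟨hres0, hres2, hres5⟩ := resid_witness q s (s * y) a hq0 hq1 ha1
    have haq1 : a * q < 1 := by nlinarith
    have hD : 0 < 2 - q - a * q := by nlinarith
    have hT6 : a * fmean L ≤ 6 := by rw [hfmean]; nlinarith [mul_pos ha0 hqs0]
    refine decAt_all_of_oneLow (a * x) (a * fmean L) (ftop L) 2 5 (resid a (wco a L) L) hax0 hax1 r0 rM r1 rmn ?_
      (by norm_num) ?_ (by norm_num) (by rw [htop]; norm_num) ?_ ?_ ?_ ?_ ?_ j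
    · -- `0 < R_a(0)`
      rw [hLdef, hg, hres0]
      exact div_pos (mul_pos (by linarith) (pow_pos (by nlinarith) 2)) hD
    · -- `2` is low: `4 < a·fmean`
      push_cast; linarith
    · -- `a·fmean < 2 + 5`
      push_cast; linarith
    · -- every other charged positive atom is self-sufficient: `1` is uncharged, `h ≥ 3` has `2h ≥ 6 ≥ a·fmean`
      intro h h1 h2 hpos
      by_cases h1' : h = 1
      · subst h1'
        exact absurd (resid_eq_zero_below ha0 ha1.le 1 q L hL' hq hR 1 one_pos (by norm_num)) (ne_of_gt hpos)
      · have h3 : (3 : ℝ) ≤ h := by exact_mod_cast (show 3 ≤ h by omega)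
        linarith
    · -- top-affordability
      have := ftop_mul_floor_le_fmean hx0 hx1 L hL
      rw [mul_assoc]
      exact mul_le_mul_of_nonneg_left this ha0.le
    · -- torque safety: `3·(a x) ≤ a·fmean − 2`
      push_cast
      rw [hfmean]
      nlinarith [mul_le_mul_of_nonneg_left hx.le ha0.le, mul_pos ha0 hqs0]
    · -- capacity of the partner `5`
      have eγ : (a * fmean L - 2 * ((2 : ℕ) : ℝ)) / (((5 : ℕ) : ℝ) - ((2 : ℕ) : ℝ)) = (3 * (a * q) * (1 + 2 * s) - 4) / 3 := by
        rw [hfmean]; push_cast; ring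
      rw [eγ, hLdef, hg, hres2, hres5]
      set Γ : ℝ := max (a * x) ((3 * (a * q) * (1 + 2 * s) - 4) / 3) with hΓ
      have key : (1 - q) * (1 - a * q) * Γ ≤ q * s * ((1 - a * q) + a * (1 - q)) * (1 - Γ) := by
        rcases le_total (a * x) ((3 * (a * q) * (1 + 2 * s) - 4) / 3) with hle | hle
        · rw [hΓ, max_eq_right hle]
          exact witness_cap_lever a q s ha0 ha1 hq0 hq1 hs0 hqs hT4'
        · rw [hΓ, max_eq_left hle]
          exact witness_cap_floor a q s (a * x) ha0 ha1 hq0 hq1 hs0 hqs (by nlinarith [mul_le_mul_of_nonneg_left hx.le ha0.le])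
      have hC : 0 ≤ 3 * a * q * (1 - s) ^ 2 / (2 - q - a * q) := div_nonneg (by positivity) hD.le
      have hmul := mul_le_mul_of_nonneg_left key hC
      calc 3 * a * q * (1 - q) * (1 - a * q) * (1 - s) ^ 2 / (2 - q - a * q) * Γ
          = 3 * a * q * (1 - s) ^ 2 / (2 - q - a * q) * ((1 - q) * (1 - a * q) * Γ) := by ring
        _ ≤ 3 * a * q * (1 - s) ^ 2 / (2 - q - a * q) * (q * s * ((1 - a * q) + a * (1 - q)) * (1 - Γ)) := hmul
        _ = 3 * a * q ^ 2 * s * (1 - s) ^ 2 * ((1 - a * q) + a * (1 - q)) / (2 - q - a * q) * (1 - Γ) := by ring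

/-- **THE WITNESS TRIPLE IS SDEC BELOW ITS LEAST MARGINAL**: `0 < q < 1`, `0 < s < 1`, `qs ≤ 1/2`, any floor `0 < x < qs`
(`sdec_flaw_of_residDECAt`; sub-forest laws SDEC by `sdec_blobLaw`, no oracle). [this work] -/
theorem sdec_witnessTriple_lt {q s : ℝ} (hq0 : 0 < q) (hq1 : q < 1) (hs0 : 0 < s) (hs1 : s < 1) (hqs : q * s ≤ 1 / 2)
    {x : ℝ} (hx0 : 0 < x) (hx : x < q * s) :
    SDEC x 9 (flaw [gluedSib 1 2 q s s, gluedSib 1 2 q s s, gluedSib 1 2 q s s]) := by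
  have hqs0 : 0 < q * s := mul_pos hq0 hs0
  have hqs1 : q * s < 1 := by linarith
  have hx1 : x < 1 := hx.trans hqs1
  set y : ℝ := x / (q * s) with hy
  have hy0 : 0 < y := div_pos hx0 hqs0
  have hy1 : y < 1 := (div_lt_one hqs0).2 hx
  have hxy : x ≤ q * (s * y) := by rw [hy, ← mul_assoc, mul_div_cancel₀ _ hqs0.ne']
  have hfl : flaw [gluedSib 1 2 q s s, gluedSib 1 2 q s s, gluedSib 1 2 q s s]
      = flaw [gluedSib 1 2 q s (s * y), gluedSib 1 2 q s (s * y), gluedSib 1 2 q s (s * y)] :=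
    flaw_replicate_gluedSib 3 1 2 q s s (s * y)
  set g : Sib := gluedSib 1 2 q s (s * y) with hg
  have hT : g.TreeOK x := gluedSib_treeOK 1 2 le_rfl (by norm_num) hq0 hq1 hs0 hs1 hy0 hy1 hxy
  have hL : ∀ t ∈ [g, g, g], t.TreeOK x := fun t ht => by
    simp only [List.mem_cons, List.mem_nil_iff, or_false] at ht
    rcases ht with h | h | h <;> rw [h] <;> exact hT
  have hρ : ∀ t ∈ [g, g, g], SDEC t.x₁ t.M t.ρ := fun t ht => by
    simp only [List.mem_cons, List.mem_nil_iff, or_false] at ht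
    have e : t = g := by rcases ht with h | h | h <;> exact h
    rw [e]
    show SDEC (s * y) (1 + 2) (slice (fun k : ℕ => if k = (1 : ℕ) then (1 : ℝ) else 0) 2 s)
    exact gluedSib_sdec 1 2 (mul_pos hs0 hy0) (by nlinarith) (by nlinarith) hs1.le
  have htop : ftop [g, g, g] = 9 := by simp only [ftop, hg]; rfl
  rw [hfl]
  have h := sdec_flaw_of_residDECAt hx0 hx1 [g, g, g] hL hρ (by simp)
    (fun a ha0 ha1 => residDECAt_witness hq0 hq1 hs0 hs1 hqs hx0 hy0 hy1 hxy ha0 ha1)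
  rw [htop] at h
  exact h

/-- **CENSUS-2's REGRESSION WITNESS FAMILY `(R¹[q](R²[s]))³` IS SDEC AT ITS FLOOR `qs` ON THE WHOLE LIGHT REGION** — every `0 < q < 1`,
`0 < s < 1` with `qs ≤ 1/2` (README V422–V430's named irreducible light triple at `q = .95`, `s = 1/2` included): the forest law on `{0..9}` is
`SDEC (qs) 9`, the list form of `SiblingStep` on this family with the oracle discharged — by a COUNT-LEVEL certificate of the residual with a
single pair `{2, 5; γ}`, no hull. [this work] -/
theorem sdec_witnessTriple {q s : ℝ} (hq0 : 0 < q) (hq1 : q < 1) (hs0 : 0 < s) (hs1 : s < 1) (hqs : q * s ≤ 1 / 2) :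
    SDEC (q * s) 9 (flaw [gluedSib 1 2 q s s, gluedSib 1 2 q s s, gluedSib 1 2 q s s]) := by
  have hqs0 : 0 < q * s := mul_pos hq0 hs0
  have hqs1 : q * s < 1 := by linarith
  have hL : ∀ t ∈ [gluedSib 1 2 q s s, gluedSib 1 2 q s s, gluedSib 1 2 q s s], t.LawOK := fun t ht => by
    simp only [List.mem_cons, List.mem_nil_iff, or_false] at ht
    have e : t = gluedSib 1 2 q s s := by rcases ht with h | h | h <;> exact h
    rw [e]
    obtain ⟨_, _, ρ0, ρM, ρ1, _⟩ := (gluedSib_treeBuiltN 1 2 hs0 hs1 (by norm_num : (0 : ℝ) < 1 / 2) (by norm_num)).lawFacts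
    exact ⟨hq0, hq1, ρ0, ρM, ρ1⟩
  obtain ⟨_, fM, _, _⟩ := flaw_facts _ hL
  have htop : ftop [gluedSib 1 2 q s s, gluedSib 1 2 q s s, gluedSib 1 2 q s s] = 9 := by simp only [ftop]; rfl
  rw [htop] at fM
  exact sdec_of_forall_lt hqs0 hqs1 fM (fun x hx0 hx => sdec_witnessTriple_lt hq0 hq1 hs0 hs1 hqs hx0 hx)

/-- **IN PARTICULAR `(R¹[19/20](R²[1/2]))³`** — census-2 g73's regression witness, the lane's named level-1-irreducible light triple
(README V427–V430) — is `SDEC (19/40) 9`. [this work] -/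
theorem sdec_witnessTriple_95_50 :
    SDEC ((19 / 20 : ℝ) * (1 / 2)) 9
      (flaw [gluedSib 1 2 (19 / 20) (1 / 2) (1 / 2), gluedSib 1 2 (19 / 20) (1 / 2) (1 / 2), gluedSib 1 2 (19 / 20) (1 / 2) (1 / 2)]) :=
  sdec_witnessTriple (by norm_num) (by norm_num) (by norm_num) (by norm_num) (by norm_num)

end LawDec
end Quant
end Summit.CriticalPhenomena.PercolationContinuityZ3.Theorems
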